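import Summits.PneNP.PneNP.Theorems.KarlinRubinMonotoneSufficesRoomParamsSize
import Summits.PneNP.PneNP.Theorems.KarlinRubinMonotoneSufficesCoverCount

/-!
# Crux `MonotoneSuffices` (stmt-PneNP-18026), the COVERING-DESIGN room theorem — part 4:
# the size of the covering family and of the detector

Notation of the room theorem (`Room.natFacts`, `Room.room_derived`): `k = ⌈n^{1/2-δ}⌉`, `L = ⌊log₂ n⌋`,
`Q = 800 n (L+1)²/k² + 1`, `t = ⌊log₂ Q⌋ + 1`, `θ = (n-t)/2^t + k/4 + 1`. The covering-design detector keeps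
`t` and `θ` but guesses only `m = (L+1) (R+1)` `t`-sets, `R = ⌊C(n,t)/C(k,t)⌋`, chosen by the averaging
argument of part 1. This file derives, for one `n`, the integer facts about `R` and `m`
(`coverNatFacts`: `m ≤ C(n,t)`, `(L+1) C(n,t) ≤ m C(k,t)`, `R k^t ≤ (2n)^t`, `(L+1) 2^{t+1} ≤ n⁴`) and the
size bound `m (n(t+1) + 60(n+3)^4 + 1) ≤ n^{(1/2+δ) t + 10} ≤ n^{(δ+2δ²+ε) log₂ n}` (`coverSizeSide`), summarised
in `cover_derived`. The exponent `δ + 2δ² = 2δ (1/2 + δ)` is `log₂` of `(n/k)^t = (n^{1/2+δ})^{2δ log₂ n}`;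
it is `< 2δ`, the exponent of the room theorem (all `C(n,t) = n^{(2δ+o(1)) log₂ n}` guesses), for every
`δ < 1/2`. Elementary arithmetic only.
-/

set_option linter.dupNamespace false -- `Summit.PneNP.PneNP.…`: summit = sub-problem name (D-0017 single-conjunct layout)

namespace Summit.PneNP.PneNP.Theorems.MonotoneSuffices.Cover

open Real Finset
open Summit.PneNP.PneNP.Theorems.MonotoneSuffices.Room

/-! ### Integer bookkeeping for `R = ⌊C(n,t)/C(k,t)⌋` and `m = (L+1)(R+1)` -/

/-- `15 (L+1) ≤ 2^L` for `L ≥ 11`. [folklore] -/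
theorem fifteen_mul_le_two_pow {L : ℕ} (hL : 11 ≤ L) : 15 * (L + 1) ≤ 2 ^ L := by
  induction L, hL using Nat.le_induction with
  | base => norm_num
  | succ L hL ih => rw [pow_succ]; omega

/-- **The integer facts of the covering family.** With `R = ⌊C(n,t)/C(k,t)⌋`, `m = (L+1)(R+1)`:
`0 < C(k,t)`, `m ≤ C(n,t)`, `(L+1) C(n,t) ≤ m C(k,t)`, `R k^t ≤ (2n)^t` and `(L+1) 2^{t+1} ≤ n⁴`. [folklore] -/
theorem coverNatFacts {n k L Q t : ℕ} (hLn : 2 ^ L ≤ n) (hL11 : 11 ≤ L)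
    (hQ : Q = 800 * n * (L + 1) ^ 2 / k ^ 2 + 1) (ht2Q : 2 ^ t ≤ 2 * Q) (ht8 : 8 ≤ t) (h8t : 8 * t ≤ k)
    (hkBig : 3200 * (L + 1) ^ 2 + 20 ≤ k) (hkn : k ≤ n) :
    0 < k.choose t ∧
    (L + 1) * (n.choose t / k.choose t + 1) ≤ n.choose t ∧
    (L + 1) * n.choose t ≤ (L + 1) * (n.choose t / k.choose t + 1) * k.choose t ∧
    n.choose t / k.choose t * k ^ t ≤ (2 * n) ^ t ∧
    (L + 1) * 2 ^ (t + 1) ≤ n ^ 4 := by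
  set R := n.choose t / k.choose t with hR
  have htk : t ≤ k := by omega
  have hpos : 0 < k.choose t := Nat.choose_pos htk
  -- `2 (L+1) ≤ k ≤ C(k,t)`
  have hkC : k ≤ k.choose t := le_choose_of_le_half (by omega) (by omega)
  have hLk : 2 * (L + 1) ≤ k := by
    have : L + 1 ≤ (L + 1) ^ 2 := by nlinarith
    omega
  have hRC : R * k.choose t ≤ n.choose t := Nat.div_mul_le_self _ _
  have hCC : k.choose t ≤ n.choose t := Nat.choose_le_choose t hkn
  -- `m ≤ C(n,t)`
  have h1 : (L + 1) * (R + 1) ≤ n.choose t := by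
    refine Nat.le_of_mul_le_mul_right ?_ hpos
    calc (L + 1) * (R + 1) * k.choose t = (L + 1) * (R * k.choose t + k.choose t) := by ring
      _ ≤ (L + 1) * (n.choose t + n.choose t) := Nat.mul_le_mul_left _ (Nat.add_le_add hRC hCC)
      _ = 2 * (L + 1) * n.choose t := by ring
      _ ≤ k.choose t * n.choose t := Nat.mul_le_mul_right _ (hLk.trans hkC)
      _ = n.choose t * k.choose t := by ring
  -- `(L+1) C(n,t) ≤ m C(k,t)`
  have h2 : (L + 1) * n.choose t ≤ (L + 1) * (R + 1) * k.choose t := by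
    have h : n.choose t ≤ (R + 1) * k.choose t := by
      rw [add_mul, one_mul]
      exact (Nat.lt_div_mul_add hpos).le
    calc (L + 1) * n.choose t ≤ (L + 1) * ((R + 1) * k.choose t) := Nat.mul_le_mul_left _ h
      _ = (L + 1) * (R + 1) * k.choose t := by ring
  -- `R k^t ≤ (2n)^t`
  have h3 : R * k ^ t ≤ (2 * n) ^ t := by
    have hRt : R * (k + 1 - t) ^ t ≤ n ^ t := by
      refine Nat.le_of_mul_le_mul_right ?_ hpos
      calc R * (k + 1 - t) ^ t * k.choose t = R * k.choose t * (k + 1 - t) ^ t := by ring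
        _ ≤ n.choose t * (k + 1 - t) ^ t := Nat.mul_le_mul_right _ hRC
        _ ≤ n ^ t * k.choose t := choose_mul_pow_le n k t
    have hk2 : k ≤ 2 * (k + 1 - t) := by omega
    calc R * k ^ t ≤ R * (2 * (k + 1 - t)) ^ t := Nat.mul_le_mul_left _ (Nat.pow_le_pow_left hk2 t)
      _ = 2 ^ t * (R * (k + 1 - t) ^ t) := by rw [mul_pow]; ring
      _ ≤ 2 ^ t * n ^ t := Nat.mul_le_mul_left _ hRt
      _ = (2 * n) ^ t := by rw [mul_pow]
  -- `(L+1) 2^{t+1} ≤ n⁴`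
  have h4 : (L + 1) * 2 ^ (t + 1) ≤ n ^ 4 := by
    have hn1 : 1 ≤ n := le_trans (Nat.one_le_two_pow) hLn
    have hQle : Q ≤ 800 * n * (L + 1) ^ 2 + 1 := by
      rw [hQ]; exact Nat.add_le_add_right (Nat.div_le_self _ _) _
    have h15 : 15 * (L + 1) ≤ n := (fifteen_mul_le_two_pow hL11).trans hLn
    have hcube : 3375 * (L + 1) ^ 3 ≤ n ^ 3 := by
      calc 3375 * (L + 1) ^ 3 = (15 * (L + 1)) ^ 3 := by ring
        _ ≤ n ^ 3 := Nat.pow_le_pow_left h15 3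
    calc (L + 1) * 2 ^ (t + 1) = 2 * ((L + 1) * 2 ^ t) := by ring
      _ ≤ 2 * ((L + 1) * (2 * Q)) := by gcongr
      _ ≤ 2 * ((L + 1) * (2 * (800 * n * (L + 1) ^ 2 + 1))) := by gcongr
      _ = 3200 * n * (L + 1) ^ 3 + 4 * (L + 1) := by ring
      _ ≤ 3200 * n * (L + 1) ^ 3 + 4 * (n * (L + 1) ^ 3) := by
          refine Nat.add_le_add_left (Nat.mul_le_mul_left 4 ?_) _
          calc L + 1 = 1 * (L + 1) ^ 1 := by ring
            _ ≤ n * (L + 1) ^ 3 := Nat.mul_le_mul hn1 (Nat.pow_le_pow_right (by omega) (by norm_num))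
      _ = 3204 * (L + 1) ^ 3 * n := by ring
      _ ≤ 3375 * (L + 1) ^ 3 * n := Nat.mul_le_mul_right _ (Nat.mul_le_mul_right _ (by norm_num))
      _ ≤ n ^ 3 * n := Nat.mul_le_mul_right _ hcube
      _ = n ^ 4 := by ring
  exact ⟨hpos, h1, h2, h3, h4⟩

/-! ### The size bound -/

set_option maxHeartbeats 400000 in
/-- **Size side of the covering-design detector.**
`(L+1)(R+1) (n(t+1) + 60(n+3)^4 + 1) ≤ n^{(1/2+δ) t + 10} ≤ n^{(δ+2δ²+ε) log₂ n}`. [folklore] -/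
theorem coverSizeSide {δ ε : ℝ} {n k L Q t : ℕ} (hδ : 0 < δ) (hδ' : δ < 1 / 2) (ht2Q : 2 ^ t ≤ 2 * Q)
    (hQk : Q * k ^ 2 ≤ 800 * n * (L + 1) ^ 2 + k ^ 2) (hk2 : k ^ 2 ≤ 4 * n) (hn : 2048 ≤ n)
    (hL11 : 11 ≤ L) (htk : t ≤ k) (hkSq : (n : ℝ) ^ (1 - 2 * δ) ≤ (k : ℝ) ^ 2)
    (hk : (n : ℝ) ^ (1 / 2 - δ) ≤ k)
    (hRk : n.choose t / k.choose t * k ^ t ≤ (2 * n) ^ t) (hL2t : (L + 1) * 2 ^ (t + 1) ≤ n ^ 4)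
    (hslack : 18 + 2 * Real.logb 2 ((L : ℝ) + 1) ≤ ε / 2 * Real.logb 2 n) :
    ((((L + 1) * (n.choose t / k.choose t + 1) * (n * (t + 1) + 60 * (n + 3) ^ 4 + 1)) : ℕ) : ℝ) ≤
      (n : ℝ) ^ ((δ + 2 * δ ^ 2 + ε) * Real.logb 2 n) := by
  set R := n.choose t / k.choose t with hR
  have hn0 : (0 : ℝ) < n := by exact_mod_cast (show 0 < n by omega)
  have hn1 : (1 : ℝ) ≤ n := by exact_mod_cast (show 1 ≤ n by omega)
  -- the inner factor `≤ n^6` (as in `Room.sizeSide`)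
  have hinner : n * (t + 1) + 60 * (n + 3) ^ 4 + 1 ≤ n ^ 6 := by
    have h6k : t + 1 ≤ n := by
      have : k ^ 2 ≤ 4 * n := hk2
      nlinarith
    have ha : n * (t + 1) ≤ n ^ 2 := by rw [sq]; exact Nat.mul_le_mul_left n h6k
    have hb : (n + 3) ^ 4 ≤ (2 * n) ^ 4 := Nat.pow_le_pow_left (by omega) 4
    have hc : 60 * (2 * n) ^ 4 ≤ n ^ 5 := by
      calc 60 * (2 * n) ^ 4 = 960 * n ^ 4 := by ring
        _ ≤ n * n ^ 4 := Nat.mul_le_mul_right _ (by omega)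
        _ = n ^ 5 := by ring
    have hd : n ^ 2 ≤ n ^ 5 := Nat.pow_le_pow_right (by omega) (by norm_num)
    have he : 1 ≤ n ^ 5 := Nat.one_le_pow _ _ (by omega)
    have hf : 3 * n ^ 5 ≤ n ^ 6 := by
      calc 3 * n ^ 5 ≤ n * n ^ 5 := Nat.mul_le_mul_right _ (by omega)
        _ = n ^ 6 := by ring
    have hb' : 60 * (n + 3) ^ 4 ≤ 60 * (2 * n) ^ 4 := Nat.mul_le_mul_left _ hb
    omega
  -- `R ≤ 2^t n^{(1/2+δ) t}`
  have hpowk : (n : ℝ) ^ ((1 / 2 - δ) * t) ≤ (k : ℝ) ^ t := by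
    rw [Real.rpow_mul_natCast hn0.le]
    exact pow_le_pow_left₀ (Real.rpow_nonneg hn0.le _) hk t
  have hP0 : (0 : ℝ) < (n : ℝ) ^ ((1 / 2 - δ) * t) := Real.rpow_pos_of_pos hn0 _
  have hRreal : (R : ℝ) ≤ 2 ^ t * (n : ℝ) ^ ((1 / 2 + δ) * t) := by
    have h1 : (R : ℝ) * (k : ℝ) ^ t ≤ (2 * n : ℝ) ^ t := by exact_mod_cast hRk
    have h2 : (R : ℝ) * (n : ℝ) ^ ((1 / 2 - δ) * t) ≤ (2 * n : ℝ) ^ t :=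
      (mul_le_mul_of_nonneg_left hpowk (Nat.cast_nonneg R)).trans h1
    refine le_of_mul_le_mul_right (h2.trans (le_of_eq ?_)) hP0
    rw [mul_assoc, ← Real.rpow_add hn0, mul_pow, ← Real.rpow_natCast (n : ℝ) t]
    ring_nf
  -- `m = (L+1)(R+1) ≤ n^4 n^{(1/2+δ) t}`
  have hbig1 : (1 : ℝ) ≤ 2 ^ t * (n : ℝ) ^ ((1 / 2 + δ) * t) :=
    one_le_mul_of_one_le_of_one_le (one_le_pow₀ (by norm_num))
      (Real.one_le_rpow hn1 (by positivity))
  have hR1 : (R : ℝ) + 1 ≤ 2 ^ (t + 1) * (n : ℝ) ^ ((1 / 2 + δ) * t) := by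
    rw [pow_succ]; linarith
  have hm : ((L : ℝ) + 1) * ((R : ℝ) + 1) ≤ (n : ℝ) ^ 4 * (n : ℝ) ^ ((1 / 2 + δ) * t) := by
    have hL2t' : ((L : ℝ) + 1) * 2 ^ (t + 1) ≤ (n : ℝ) ^ 4 := by exact_mod_cast hL2t
    calc ((L : ℝ) + 1) * ((R : ℝ) + 1) ≤ ((L : ℝ) + 1) * (2 ^ (t + 1) * (n : ℝ) ^ ((1 / 2 + δ) * t)) :=
          mul_le_mul_of_nonneg_left hR1 (by positivity)
      _ = (((L : ℝ) + 1) * 2 ^ (t + 1)) * (n : ℝ) ^ ((1 / 2 + δ) * t) := by ring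
      _ ≤ (n : ℝ) ^ 4 * (n : ℝ) ^ ((1 / 2 + δ) * t) :=
          mul_le_mul_of_nonneg_right hL2t' (Real.rpow_nonneg hn0.le _)
  -- so the size is `≤ n^{(1/2+δ) t + 10}`
  have hS : ((((L + 1) * (R + 1) * (n * (t + 1) + 60 * (n + 3) ^ 4 + 1)) : ℕ) : ℝ) ≤
      (n : ℝ) ^ ((1 / 2 + δ) * t + 10) := by
    have h1 : (L + 1) * (R + 1) * (n * (t + 1) + 60 * (n + 3) ^ 4 + 1) ≤ (L + 1) * (R + 1) * n ^ 6 :=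
      Nat.mul_le_mul_left _ hinner
    have h2 : ((((L + 1) * (R + 1) * (n * (t + 1) + 60 * (n + 3) ^ 4 + 1)) : ℕ) : ℝ) ≤
        (((L + 1) * (R + 1) * n ^ 6 : ℕ) : ℝ) := by exact_mod_cast h1
    refine h2.trans ?_
    push_cast
    calc ((L : ℝ) + 1) * ((R : ℝ) + 1) * (n : ℝ) ^ 6 ≤ ((n : ℝ) ^ 4 * (n : ℝ) ^ ((1 / 2 + δ) * t)) * (n : ℝ) ^ 6 :=
          mul_le_mul_of_nonneg_right hm (by positivity)
      _ = (n : ℝ) ^ ((1 / 2 + δ) * t + 10) := by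
          rw [Real.rpow_add hn0, show (10 : ℝ) = ((10 : ℕ) : ℝ) by norm_num, Real.rpow_natCast]
          ring
  -- the bound on `t`: `t ≤ 11 + 2δ log₂ n + 2 log₂ (L+1)` (as in `Room.sizeSide`)
  have h2tk : (2 : ℝ) ^ t * (k : ℝ) ^ 2 ≤ 1602 * n * ((L : ℝ) + 1) ^ 2 := by
    have h : 2 ^ t * k ^ 2 ≤ 1602 * n * (L + 1) ^ 2 := by
      have hL4 : 4 ≤ (L + 1) ^ 2 := by nlinarith
      have hA : 800 * n * (L + 1) ^ 2 + 4 * n ≤ 801 * n * (L + 1) ^ 2 := by nlinarith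
      calc 2 ^ t * k ^ 2 ≤ 2 * Q * k ^ 2 := Nat.mul_le_mul_right _ ht2Q
        _ = 2 * (Q * k ^ 2) := by ring
        _ ≤ 2 * (800 * n * (L + 1) ^ 2 + k ^ 2) := Nat.mul_le_mul_left _ hQk
        _ ≤ 2 * (800 * n * (L + 1) ^ 2 + 4 * n) := by omega
        _ ≤ 2 * (801 * n * (L + 1) ^ 2) := Nat.mul_le_mul_left _ hA
        _ = 1602 * n * (L + 1) ^ 2 := by ring
    have h' : ((2 ^ t * k ^ 2 : ℕ) : ℝ) ≤ ((1602 * n * (L + 1) ^ 2 : ℕ) : ℝ) := by exact_mod_cast h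
    push_cast at h'
    exact h'
  have hpow0 : (0 : ℝ) < (n : ℝ) ^ (1 - 2 * δ) := Real.rpow_pos_of_pos hn0 _
  have h2t : (2 : ℝ) ^ t ≤ 1602 * (n : ℝ) ^ (2 * δ) * ((L : ℝ) + 1) ^ 2 := by
    have hsplit : (n : ℝ) ^ (2 * δ) * (n : ℝ) ^ (1 - 2 * δ) = n := by
      rw [← Real.rpow_add hn0]; norm_num
    have h1 : (2 : ℝ) ^ t * (n : ℝ) ^ (1 - 2 * δ) ≤
        (1602 * (n : ℝ) ^ (2 * δ) * ((L : ℝ) + 1) ^ 2) * (n : ℝ) ^ (1 - 2 * δ) := by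
      calc (2 : ℝ) ^ t * (n : ℝ) ^ (1 - 2 * δ) ≤ (2 : ℝ) ^ t * (k : ℝ) ^ 2 :=
            mul_le_mul_of_nonneg_left hkSq (by positivity)
        _ ≤ 1602 * n * ((L : ℝ) + 1) ^ 2 := h2tk
        _ = (1602 * (n : ℝ) ^ (2 * δ) * ((L : ℝ) + 1) ^ 2) * (n : ℝ) ^ (1 - 2 * δ) := by
            rw [show (1602 * (n : ℝ) ^ (2 * δ) * ((L : ℝ) + 1) ^ 2) * (n : ℝ) ^ (1 - 2 * δ) =
              1602 * ((n : ℝ) ^ (2 * δ) * (n : ℝ) ^ (1 - 2 * δ)) * ((L : ℝ) + 1) ^ 2 by ring, hsplit]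
    exact le_of_mul_le_mul_right h1 hpow0
  have hlog : (t : ℝ) ≤ Real.logb 2 1602 + 2 * δ * Real.logb 2 n + 2 * Real.logb 2 ((L : ℝ) + 1) := by
    have h1 : Real.logb 2 ((2 : ℝ) ^ t) ≤ Real.logb 2 (1602 * (n : ℝ) ^ (2 * δ) * ((L : ℝ) + 1) ^ 2) :=
      Real.logb_le_logb_of_le one_lt_two (by positivity) h2t
    have h2 : Real.logb 2 ((2 : ℝ) ^ t) = t := by
      rw [Real.logb_pow, Real.logb_self_eq_one one_lt_two, mul_one]
    have h3 : Real.logb 2 (1602 * (n : ℝ) ^ (2 * δ) * ((L : ℝ) + 1) ^ 2) =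
        Real.logb 2 1602 + 2 * δ * Real.logb 2 n + 2 * Real.logb 2 ((L : ℝ) + 1) := by
      rw [Real.logb_mul (by positivity) (by positivity), Real.logb_mul (by norm_num) (by positivity),
        Real.logb_rpow_eq_mul_logb_of_pos hn0, Real.logb_pow]
      push_cast
      ring
    linarith
  have h1602 : Real.logb 2 1602 < 11 := by
    have h : Real.logb 2 1602 < Real.logb 2 2048 := Real.logb_lt_logb one_lt_two (by norm_num) (by norm_num)
    have h2048 : Real.logb 2 (2048 : ℝ) = 11 := by
      rw [show (2048 : ℝ) = 2 ^ (11 : ℕ) by norm_num, Real.logb_pow, Real.logb_self_eq_one one_lt_two]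
      norm_num
    linarith
  -- the exponent comparison
  have hu0 : 0 ≤ Real.logb 2 ((L : ℝ) + 1) :=
    Real.logb_nonneg one_lt_two (by have : (0 : ℝ) ≤ L := Nat.cast_nonneg L; linarith)
  have hℓ0 : 0 ≤ Real.logb 2 (n : ℝ) := Real.logb_nonneg one_lt_two hn1
  have ht0 : (0 : ℝ) ≤ t := Nat.cast_nonneg t
  have hexp : (1 / 2 + δ) * t + 10 ≤ (δ + 2 * δ ^ 2 + ε) * Real.logb 2 n := by
    set u := Real.logb 2 ((L : ℝ) + 1) with hu
    set ℓ := Real.logb 2 (n : ℝ) with hℓ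
    have hA : (1 / 2 + δ) * (t : ℝ) ≤ (1 / 2 + δ) * (11 + 2 * δ * ℓ + 2 * u) :=
      mul_le_mul_of_nonneg_left (by linarith) (by linarith)
    have hB : (1 / 2 + δ) * (11 + 2 * u) ≤ 11 + 2 * u := by nlinarith
    nlinarith
  exact hS.trans (Real.rpow_le_rpow_of_exponent_le hn1 hexp)

/-- **The derived parameters of the covering-design detector.** From the base inequalities (with the
log-slack at `ε/2`): `0 < C(k,t)`, `m ≤ C(n,t)`, `(L+1) C(n,t) ≤ m C(k,t)` and
`m (n(t+1) + 60(n+3)^4 + 1) ≤ n^{(δ+2δ²+ε) log₂ n}`, where `m = (L+1)(⌊C(n,t)/C(k,t)⌋ + 1)`. [folklore] -/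
theorem cover_derived {δ ε : ℝ} {n k L Q t : ℕ} (hδ : 0 < δ) (hδ' : δ < 1 / 2)
    (hL : L = Nat.log 2 n) (hQ : Q = 800 * n * (L + 1) ^ 2 / k ^ 2 + 1)
    (ht : t = Nat.log 2 Q + 1) (hn : 2048 ≤ n) (hkBig : 3200 * (L + 1) ^ 2 + 20 ≤ k) (h6k : 6 * k ≤ n)
    (hk2 : k ^ 2 ≤ 4 * n) (hkSq : (n : ℝ) ^ (1 - 2 * δ) ≤ (k : ℝ) ^ 2) (hk : (n : ℝ) ^ (1 / 2 - δ) ≤ k)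
    (hslack : 18 + 2 * Real.logb 2 ((L : ℝ) + 1) ≤ ε / 2 * Real.logb 2 n) :
    0 < k.choose t ∧
    (L + 1) * (n.choose t / k.choose t + 1) ≤ n.choose t ∧
    (L + 1) * n.choose t ≤ (L + 1) * (n.choose t / k.choose t + 1) * k.choose t ∧
    ((((L + 1) * (n.choose t / k.choose t + 1) * (n * (t + 1) + 60 * (n + 3) ^ 4 + 1)) : ℕ) : ℝ) ≤
      (n : ℝ) ^ ((δ + 2 * δ ^ 2 + ε) * Real.logb 2 n) := by
  obtain ⟨-, ht2Q, hQk, -, ht8, -, h8t, hE3, hLn, -, hL11⟩ := natFacts hL hQ ht hn hkBig h6k hk2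
  have hkn : k ≤ n := by omega
  obtain ⟨hpos, h1, h2, h3, h4⟩ := coverNatFacts hLn hL11 hQ ht2Q ht8 h8t hkBig hkn
  exact ⟨hpos, h1, h2, coverSizeSide hδ hδ' ht2Q hQk hk2 hn hL11 (by omega) hkSq hk h3 h4 hslack⟩

end Summit.PneNP.PneNP.Theorems.MonotoneSuffices.Cover

namespace Summit.PneNP.PneNP.Theorems.MonotoneSuffices.Cover

open Finset

/-- Registered sub-goal `cover_params` of stmt-PneNP-18026 (covering-design room theorem, part 4): the derived
parameter facts of the covering family, exported verbatim. [folklore] -/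
theorem cover_params :
    ∀ {δ ε : ℝ} {n k L Q t : ℕ}, 0 < δ → δ < 1 / 2 → L = Nat.log 2 n → Q = 800 * n * (L + 1) ^ 2 / k ^ 2 + 1 → t = Nat.log 2 Q + 1 → 2048 ≤ n → 3200 * (L + 1) ^ 2 + 20 ≤ k → 6 * k ≤ n → k ^ 2 ≤ 4 * n → (n : ℝ) ^ (1 - 2 * δ) ≤ (k : ℝ) ^ 2 → (n : ℝ) ^ (1 / 2 - δ) ≤ k → 18 + 2 * Real.logb 2 ((L : ℝ) + 1) ≤ ε / 2 * Real.logb 2 n → 0 < k.choose t ∧ (L + 1) * (n.choose t / k.choose t + 1) ≤ n.choose t ∧ (L + 1) * n.choose t ≤ (L + 1) * (n.choose t / k.choose t + 1) * k.choose t ∧ ((((L + 1) * (n.choose t / k.choose t + 1) * (n * (t + 1) + 60 * (n + 3) ^ 4 + 1)) : ℕ) : ℝ) ≤ (n : ℝ) ^ ((δ + 2 * δ ^ 2 + ε) * Real.logb 2 n) :=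
  fun hδ hδ' hL hQ ht hn hkBig h6k hk2 hkSq hk hslack => cover_derived hδ hδ' hL hQ ht hn hkBig h6k hk2 hkSq hk hslack

end Summit.PneNP.PneNP.Theorems.MonotoneSuffices.Cover
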